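import Summits.CriticalPhenomena.SAWScalingLimit.Theorems.AvoidanceLimit.Negative.AvoidanceLimitExponentRigidity
import Summits.CriticalPhenomena.SAWScalingLimit.Theorems.IsingBoundaryRatio.Negative.IsingBoundaryRatioNesting
import Literature.Probability.LatticeModels.DiluteLoopModelSAWLaw
import Literature.Probability.Percolation.CLE6Proofs
import Literature.Probability.RandomPlanarGeometry.SelfAvoidingWalkProofs

/-!
# Negative knowledge on crux `AvoidanceLimit`, part 6: kill criteria and the endpoint transfer

Support file (refuter / cdisprove lane, cycle 3) for the crux
`Summit.CriticalPhenomena.SAWScalingLimit.Theses.SAWLoopFugacityFlow.AvoidanceLimit`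
(stmt-CriticalPhenomena-10649, route SAWLoopFugacityFlow, rank 2): for every Dobrushin domain
`(D; a, b)`, hull subdomain `D'`, endpoint approximation, chordal uniformizer `φ`, pulled-back hull
`A = closure (ℍ ∖ φ⁻¹ D')` and restriction data `(Φ, d = Φ'_A(0))`,
`P_δ(range γ_δ ⊆ closure D') → d^(5/8)` as `δ → 0+`. The crux is NOT refuted. This part makes
precise, as kernel-checked theorems, what a LATTICE refutation would have to exhibit, and proves
that the cheap one is impossible in the reference square of all current lines:

* `restrictionDeriv_pos_le_one` — under the crux's hypotheses `d` is the honest derivative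
  `Φ'_A(0) ∈ (0, 1]` of the `*`-hull `A` (no junk value of `d` is reachable), and `d < 1` as soon as
  `D' ≠ D` (`restrictionDeriv_lt_one`, part 5, with `pullbackHull_inter_nonempty`);
* `avoidanceLimit_eventually_pos` / `avoidanceLimit_eventually_lt_one` / `avoidanceLimit_window` —
  the crux forces, along every datum, `c ≤ P_δ ≤ 1 - c` for some `c > 0` and all small `δ`
  (generalising part 5's strip window to every hull subdomain `D' ≠ D`);
* `not_avoidanceLimit_of_frequently_zero` / `not_avoidanceLimit_of_frequently_one` — the two KILL
  CRITERIA: a refutation from below needs a datum with `P_δ = 0` for meshes accumulating at `0`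
  (no SAW of `Ω_δ` from `a_δ` to `b_δ` inside `closure D'`), one from above needs `P_δ = 1`
  frequently with `D' ≠ D`;
* `map_law_rangeSubset_pos_of_reachable`, `eventually_map_law_rangeSubset_pos` (reusing
  `mem_meshDomain_of_reachable_ne`, `eventually_ne` of the IsingBoundaryRatio Negative lane) — ONE self-avoiding
  path of the sub-domain graph `Ω'_δ` from `a_δ` to `b_δ` already gives `P_δ > 0` (sub-domain walks
  are confined walks of `Ω_δ`: `edges_mem_edgeSet_of_subset`; the law is a genuine probability with
  atoms `x_c^n / Z > 0`), so criterion 1 can never be met along data that are ALSO endpoint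
  approximations of `D'`;
* `isEndpointApprox_of_hull_of_axisCaps` (**endpoint transfer**, the main theorem of parts 6–8) —
  for `D` with real marked points near which `D` is stable under vertical shrinking towards the axis
  and meets the axis in an interval accumulating at the marked point (rectangles marked on vertical
  sides, discs, …), every endpoint approximation of `D` IS one of each hull subdomain `D'`: lattice
  staircases inside the caps `D ∩ B(pt i, ε) ⊆ D'` (`stair`) bring `a_δ, b_δ` next to axis points
  of `D`, inside a fixed compact `K ⊆ D'`, and the tree's theorem "the largest mesh component of a
  Jordan domain is the bulk" (`JordanDomain.exists_forall_mem_meshDomain_and_reachable`) puts them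
  in `Ω'_δ` and joins them; instances `isEndpointApprox_of_hull_bigSq` (reference square) and
  `isEndpointApprox_of_hull_unitDisc` (the tree's `DobrushinDomain.unitDisc`). Hence `eventually_pos_bigSq`: NO probability-zero kill of the
  crux exists in the square, for any hull subdomain and ANY endpoint approximation (mesoscopic
  depth, tangential approach, … included) — unconditionally, no SAW estimate involved. The general
  statement `EndpointTransfer` (all Jordan `D`) is recorded as a `Prop` with a paper proof sketch;
  it is the lattice-topology content of the route's "largest-component bookkeeping" and makes the
  double hypothesis of `IsingBoundaryRatio` redundant for `D = bigSq`.

[folklore]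
-/

noncomputable section

open Set Filter Topology MeasureTheory Complex Metric
open UpperHalfPlane (upperHalfPlaneSet isOpen_upperHalfPlaneSet)
open Literature.Probability.RandomPlanarGeometry Literature.Probability.LatticeModels
open Summit.CriticalPhenomena.SAWScalingLimit.Theses.SAWLoopFugacityFlow (AvoidanceLimit)
open Summit.CriticalPhenomena.SAWScalingLimit.Theorems.IsingBoundaryRatio.Negative
  (mem_meshDomain_of_reachable_ne eventually_ne)
open scoped ENNReal

namespace Summit.CriticalPhenomena.SAWScalingLimit.Theorems.AvoidanceLimit.Negative

/-! ### Lattice side: one confined self-avoiding path makes the avoidance probability positive -/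

/-- The trace of the class of a SAW is the trace of its polyline. [folklore] -/
theorem range_curve {Ω : Set ℂ} {δ : ℝ} {a b : Site 2} (γ : SAW.DomainSAW Ω δ a b) :
    γ.curve.range = Set.range (γ.walk.toCurve (meshPoint δ)) := rfl

/-- If every closed edge of a SAW between distinct vertices lies in `S`, its polyline lies in `S`.
[folklore] -/
theorem curve_mem_rangeSubset {Ω : Set ℂ} {δ : ℝ} {a b : Site 2} {S : Set ℂ}
    (γ : SAW.DomainSAW Ω δ a b) (hab : a ≠ b)
    (h : ∀ d ∈ γ.walk.darts, segment ℝ (meshPoint δ d.fst) (meshPoint δ d.snd) ⊆ S) :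
    γ.curve ∈ CurveClass.rangeSubset S := by
  rw [CurveClass.mem_rangeSubset, range_curve]
  exact SimpleGraph.Walk.range_toCurve_subset_of_not_nil (fun hnil ↦ hab hnil.eq) h

/-- The critical SAW law of a bounded domain gives positive mass to every non-empty set of walks
from a vertex of `Ω_δ` to a different vertex (total weight finite, single weights `x_c^n > 0`).
[folklore] -/
theorem law_apply_pos {Ω : Set ℂ} (hΩ : Bornology.IsBounded Ω) {δ : ℝ} (hδ : 0 < δ) {a b : Site 2}
    (ha : a ∈ meshDomain Ω δ) (hab : a ≠ b) {s : Set (SAW.DomainSAW Ω δ a b)} (hs : s.Nonempty) :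
    0 < SAW.law Ω δ a b s := by
  have ha' : a ∈ meshDomainFinset Ω δ := by
    rw [← Finset.mem_coe, coe_meshDomainFinset hΩ hδ]; exact ha
  obtain ⟨γ, hγ⟩ := hs
  rw [SAW.law, Measure.smul_apply, smul_eq_mul]
  refine ENNReal.mul_pos ?_ ?_
  · rw [Ne, ENNReal.inv_eq_zero, DiluteLoopModel.SAW.weight_univ_eq_domainPartitionFunction ha' hab]
    exact ENNReal.ofReal_ne_top
  · refine (lt_of_lt_of_le ?_ (measure_mono (singleton_subset_iff.2 hγ))).ne'
    rw [SAW.weight_singleton]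
    exact ENNReal.ofReal_pos.2 (pow_pos SAW.criticalFugacity_pos_lt_one'.1 _)

/-- **One confined path makes the avoidance probability positive.** If `Ω_δ` contains a
self-avoiding path from `a` to `b ≠ a` all of whose closed edges lie in `S`, then
`P_δ(range ⊆ S) > 0` for the critical SAW of the bounded domain `Ω`. [folklore] -/
theorem map_law_rangeSubset_pos {Ω : Set ℂ} (hΩ : Bornology.IsBounded Ω) {δ : ℝ} (hδ : 0 < δ)
    {a b : Site 2} (hab : a ≠ b) {S : Set ℂ} (p : (discreteDomainGraph Ω δ).Walk a b)
    (hp : p.IsPath) (hS : ∀ d ∈ p.darts, segment ℝ (meshPoint δ d.fst) (meshPoint δ d.snd) ⊆ S) :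
    0 < ((SAW.law Ω δ a b).map (fun γ ↦ γ.curve)) (CurveClass.rangeSubset S) := by
  have ha : a ∈ meshDomain Ω δ := mem_meshDomain_of_reachable_ne ⟨p⟩ hab
  refine lt_of_lt_of_le ?_ (Measure.le_map_apply (SAW.aemeasurable_curve Ω δ a b) _)
  exact law_apply_pos hΩ hδ ha hab ⟨⟨p, hp⟩, curve_mem_rangeSubset ⟨p, hp⟩ hab hS⟩

/-! ### Sub-domain walks are confined walks of the big domain -/

/-- The edges of a walk of `Ω'_δ` (`Ω' ⊆ Ω`) starting at a vertex of `Ω_δ` are edges of `Ω_δ`: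
vertices of `Ω'_δ` lie in `Ω' ⊆ Ω`, closed edges in `closure Ω' ⊆ closure Ω`, and `Ω_δ` is a union
of mesh components. [folklore] -/
theorem edges_mem_edgeSet_of_subset {Ω Ω' : Set ℂ} (hsub : Ω' ⊆ Ω) {δ : ℝ} :
    ∀ {u v : Site 2} (q : (discreteDomainGraph Ω' δ).Walk u v), u ∈ meshDomain Ω δ →
      ∀ e ∈ q.edges, e ∈ (discreteDomainGraph Ω δ).edgeSet
  | _, _, .nil, _ => by simp
  | u, v, .cons (v := w) hadj q, hu => by
    have h' := discreteDomainGraph_adj_iff.1 hadj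
    have hm' := meshGraph_adj_iff.1 h'.1
    have hadjΩ : (meshGraph Ω δ).Adj u w :=
      meshGraph_adj_iff.2 ⟨hm'.1, hm'.2.trans (closure_mono hsub)⟩
    have hu' : u ∈ meshVertices Ω δ := meshDomain_subset_meshVertices _ _ hu
    have hw' : w ∈ meshVertices Ω δ := hsub (meshDomain_subset_meshVertices _ _ h'.2.2)
    have hw : w ∈ meshDomain Ω δ :=
      mem_meshDomain_of_adj (u := ⟨u, hu'⟩) (w := ⟨w, hw'⟩) hu
        (by simpa only [SimpleGraph.comap_adj, Function.Embedding.subtype_apply] using hadjΩ)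
    intro e he
    rw [SimpleGraph.Walk.edges_cons, List.mem_cons] at he
    rcases he with rfl | he
    · exact (SimpleGraph.mem_edgeSet _).2 (discreteDomainGraph_adj_iff.2 ⟨hadjΩ, hu, hw⟩)
    · exact edges_mem_edgeSet_of_subset hsub q hw e he

/-- **A joinable sub-domain gives positive avoidance probability.** If `a ≠ b` are joined in
`Ω'_δ` for some `Ω' ⊆ Ω` (bounded `Ω`, `δ > 0`) and `a ∈ Ω_δ`, then the critical SAW of `Ω_δ` from
`a` to `b` stays in `closure Ω'` with positive probability. [folklore] -/
theorem map_law_rangeSubset_pos_of_reachable {Ω Ω' : Set ℂ} (hΩ : Bornology.IsBounded Ω)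
    (hsub : Ω' ⊆ Ω) {δ : ℝ} (hδ : 0 < δ) {a b : Site 2} (hab : a ≠ b) (ha : a ∈ meshDomain Ω δ)
    (hr : (discreteDomainGraph Ω' δ).Reachable a b) :
    0 < ((SAW.law Ω δ a b).map (fun γ ↦ γ.curve)) (CurveClass.rangeSubset (closure Ω')) := by
  obtain ⟨q⟩ := hr
  set q' := q.toPath with hq'
  have hedges := edges_mem_edgeSet_of_subset hsub (q' : (discreteDomainGraph Ω' δ).Walk a b) ha
  set p := (q' : (discreteDomainGraph Ω' δ).Walk a b).transfer (discreteDomainGraph Ω δ) hedges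
    with hpdef
  have hp : p.IsPath := q'.2.transfer _
  refine map_law_rangeSubset_pos hΩ hδ hab p hp fun d hd ↦ ?_
  have he : d.edge ∈ (q' : (discreteDomainGraph Ω' δ).Walk a b).edges := by
    rw [← SimpleGraph.Walk.edges_transfer _ hedges]
    exact List.mem_map.2 ⟨d, hd, rfl⟩
  have hadj : (discreteDomainGraph Ω' δ).Adj d.fst d.snd :=
    (SimpleGraph.Walk.adj_of_mem_edges _ he)
  exact (meshGraph_adj_iff.1 (discreteDomainGraph_adj_iff.1 hadj).1).2

/-- **Eventual positivity from an endpoint approximation of the SUB-domain.** If `(a_δ, b_δ)` is an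
endpoint approximation of `D` AND of `D' ⊆ D`, then eventually `P_δ(range γ_δ ⊆ closure D') > 0`
for the critical SAW of `D`: a "probability-zero" refutation of the crux along such data is
impossible. [folklore] -/
theorem eventually_map_law_rangeSubset_pos {D D' : DobrushinDomain} {a b : ℝ → Site 2}
    (hab : SAW.IsEndpointApprox D a b) (hab' : SAW.IsEndpointApprox D' a b)
    (hsub : D'.carrier ⊆ D.carrier) :
    ∀ᶠ δ in 𝓝[>] (0 : ℝ), 0 < ((SAW.law D.carrier δ (a δ) (b δ)).map (fun γ ↦ γ.curve))
      (CurveClass.rangeSubset (closure D'.carrier)) := by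
  filter_upwards [hab.reachable, hab'.reachable, eventually_ne hab, self_mem_nhdsWithin]
    with δ hr hr' hne' hδ
  exact map_law_rangeSubset_pos_of_reachable D.isBounded hsub hδ hne'
    (mem_meshDomain_of_reachable_ne hr hne') hr'


/-! ### Restriction side: the crux's `d` is the honest derivative `Φ'_A(0) ∈ (0, 1]`, `< 1` off `D' = D` -/

/-- The inline hull hypotheses of the crux give the tree's `IsHullSubdomain` (ball agreement ⇒ the
marked points are off `closure (D ∖ D')`). (Same statement as the symplectic-fermion-anchor
skeleton's lemma of that name; reproved here to keep the Negative lane self-contained.) [folklore] -/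
theorem isHullSubdomain_of_ball {D D' : DobrushinDomain} (hsub : D'.carrier ⊆ D.carrier)
    (h0 : D'.pt 0 = D.pt 0) (h1 : D'.pt 1 = D.pt 1)
    (hball : ∃ ε : ℝ, 0 < ε ∧ D'.carrier ∩ ball (D.pt 0) ε = D.carrier ∩ ball (D.pt 0) ε ∧
      D'.carrier ∩ ball (D.pt 1) ε = D.carrier ∩ ball (D.pt 1) ε) :
    D.IsHullSubdomain D' := by
  obtain ⟨ε, hε, hb0, hb1⟩ := hball
  have key : ∀ p : ℂ, D'.carrier ∩ ball p ε = D.carrier ∩ ball p ε →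
      p ∉ closure (D.carrier \ D'.carrier) := by
    intro p hp hmem
    rw [mem_closure_iff_nhds] at hmem
    obtain ⟨z, hzb, hzD, hzD'⟩ := hmem (ball p ε) (ball_mem_nhds p hε)
    have hz : z ∈ D'.carrier ∩ ball p ε := by rw [hp]; exact ⟨hzD, hzb⟩
    exact hzD' hz.1
  exact ⟨hsub, h0, h1, key _ hb0, key _ hb1⟩

/-- **No junk `d`**: under the crux's hypotheses the number `d` IS `Φ'_A(0) ∈ (0, 1]` — the pulled-back
hull is a `*`-hull (`IsStarHull.pullbackHull`), its restriction derivative exists in `(0, 1]` and is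
unique. [folklore] -/
theorem restrictionDeriv_pos_le_one {D D' : DobrushinDomain} (hsub : D'.carrier ⊆ D.carrier)
    (h0 : D'.pt 0 = D.pt 0) (h1 : D'.pt 1 = D.pt 1)
    (hball : ∃ ε : ℝ, 0 < ε ∧ D'.carrier ∩ ball (D.pt 0) ε = D.carrier ∩ ball (D.pt 0) ε ∧
      D'.carrier ∩ ball (D.pt 1) ε = D.carrier ∩ ball (D.pt 1) ε)
    {φ : ConformalEquiv upperHalfPlaneSet D.carrier} (hφ : D.IsChordalUniformizing φ)
    {A : Set ℂ} (hA : A = closure (upperHalfPlaneSet \ {z | z ∈ upperHalfPlaneSet ∧ φ z ∈ D'.carrier}))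
    {Φ : ConformalEquiv (upperHalfPlaneSet \ A) upperHalfPlaneSet} {d : ℝ}
    (hΦ : IsRestrictionMap A Φ) (hd : HasRestrictionDeriv A Φ d) :
    IsStarHull A ∧ 0 < d ∧ d ≤ 1 := by
  subst hA
  have hstar : IsStarHull (φ.pullbackHull D') :=
    IsStarHull.pullbackHull JordanDomain.isSimplyConnected_holds hφ
      (isHullSubdomain_of_ball hsub h0 h1 hball)
  obtain ⟨d₀, hd₀, hd₀1, hd₀'⟩ := IsStarHull.exists_hasRestrictionDeriv_holds hstar hΦ
  have hdd : d = d₀ := hd.unique hstar hd₀'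
  exact ⟨hstar, hdd ▸ hd₀, hdd ▸ hd₀1⟩

/-- A point of `D ∖ D'` pulls back into the hull: `A ∩ ℍ ≠ ∅` as soon as `D' ≠ D`. [folklore] -/
theorem pullbackHull_inter_nonempty {D D' : DobrushinDomain}
    (φ : ConformalEquiv upperHalfPlaneSet D.carrier) {w : ℂ} (hw : w ∈ D.carrier)
    (hw' : w ∉ D'.carrier) : (φ.pullbackHull D' ∩ upperHalfPlaneSet).Nonempty := by
  have hz : φ.symm w ∈ upperHalfPlaneSet := φ.symm_mapsTo hw
  refine ⟨φ.symm w, subset_closure ⟨hz, ?_⟩, hz⟩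
  rintro ⟨-, h⟩
  rw [φ.apply_symm_apply hw] at h
  exact hw' h

/-! ### What the crux forbids eventually: the two lattice kill criteria -/

/-- **The crux forces eventual positivity** of `P_δ(range γ_δ ⊆ closure D')` along every datum
(its limit is `d^{5/8} > 0`). [folklore] -/
theorem avoidanceLimit_eventually_pos (h : AvoidanceLimit) {D D' : DobrushinDomain}
    {a b : ℝ → Site 2} (hab : SAW.IsEndpointApprox D a b) (hsub : D'.carrier ⊆ D.carrier)
    (h0 : D'.pt 0 = D.pt 0) (h1 : D'.pt 1 = D.pt 1)
    (hball : ∃ ε : ℝ, 0 < ε ∧ D'.carrier ∩ ball (D.pt 0) ε = D.carrier ∩ ball (D.pt 0) ε ∧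
      D'.carrier ∩ ball (D.pt 1) ε = D.carrier ∩ ball (D.pt 1) ε)
    {φ : ConformalEquiv upperHalfPlaneSet D.carrier} (hφ : D.IsChordalUniformizing φ)
    {A : Set ℂ} (hA : A = closure (upperHalfPlaneSet \ {z | z ∈ upperHalfPlaneSet ∧ φ z ∈ D'.carrier}))
    {Φ : ConformalEquiv (upperHalfPlaneSet \ A) upperHalfPlaneSet} {d : ℝ}
    (hΦ : IsRestrictionMap A Φ) (hd : HasRestrictionDeriv A Φ d) :
    ∀ᶠ δ in 𝓝[>] (0 : ℝ), 0 < ((SAW.law D.carrier δ (a δ) (b δ)).map (fun γ ↦ γ.curve))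
      (CurveClass.rangeSubset (closure D'.carrier)) := by
  have key := h D D' a b hab hsub h0 h1 hball φ hφ A hA Φ d hΦ hd
  have hd0 : 0 < d := (restrictionDeriv_pos_le_one hsub h0 h1 hball hφ hA hΦ hd).2.1
  exact (tendsto_order.1 key).1 _ (ENNReal.ofReal_pos.2 (Real.rpow_pos_of_pos hd0 _))

/-- **The crux forces the avoidance probability eventually below `1`** as soon as `D' ≠ D`
(its limit is `d^{5/8}` with `d < 1`, `restrictionDeriv_lt_one`). [folklore] -/
theorem avoidanceLimit_eventually_lt_one (h : AvoidanceLimit) {D D' : DobrushinDomain}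
    {a b : ℝ → Site 2} (hab : SAW.IsEndpointApprox D a b) (hsub : D'.carrier ⊆ D.carrier)
    (h0 : D'.pt 0 = D.pt 0) (h1 : D'.pt 1 = D.pt 1)
    (hball : ∃ ε : ℝ, 0 < ε ∧ D'.carrier ∩ ball (D.pt 0) ε = D.carrier ∩ ball (D.pt 0) ε ∧
      D'.carrier ∩ ball (D.pt 1) ε = D.carrier ∩ ball (D.pt 1) ε)
    (hne : (D.carrier \ D'.carrier).Nonempty)
    {φ : ConformalEquiv upperHalfPlaneSet D.carrier} (hφ : D.IsChordalUniformizing φ)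
    {A : Set ℂ} (hA : A = closure (upperHalfPlaneSet \ {z | z ∈ upperHalfPlaneSet ∧ φ z ∈ D'.carrier}))
    {Φ : ConformalEquiv (upperHalfPlaneSet \ A) upperHalfPlaneSet} {d : ℝ}
    (hΦ : IsRestrictionMap A Φ) (hd : HasRestrictionDeriv A Φ d) :
    ∀ᶠ δ in 𝓝[>] (0 : ℝ), ((SAW.law D.carrier δ (a δ) (b δ)).map (fun γ ↦ γ.curve))
      (CurveClass.rangeSubset (closure D'.carrier)) < 1 := by
  have key := h D D' a b hab hsub h0 h1 hball φ hφ A hA Φ d hΦ hd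
  obtain ⟨hstar, hd0, -⟩ := restrictionDeriv_pos_le_one hsub h0 h1 hball hφ hA hΦ hd
  obtain ⟨w, hw, hw'⟩ := hne
  have hAne : (A ∩ upperHalfPlaneSet).Nonempty := by
    subst hA; exact pullbackHull_inter_nonempty φ hw hw'
  have hd1 : d < 1 := restrictionDeriv_lt_one hstar hΦ hd hAne
  refine (tendsto_order.1 key).2 _ ?_
  show ENNReal.ofReal (d ^ ((5 : ℝ) / 8)) < 1
  rw [← ENNReal.ofReal_one, ENNReal.ofReal_lt_ofReal_iff zero_lt_one]
  exact Real.rpow_lt_one hd0.le hd1 (by norm_num)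

/-- **Kill criterion 1 (probability zero).** A refutation of the crux "from below" must exhibit a
Dobrushin domain, a hull subdomain and an endpoint approximation along which, for mesh sizes
accumulating at `0`, NO self-avoiding walk of `Ω_δ` from `a_δ` to `b_δ` stays in `closure D'`
(`P_δ = 0` frequently). By `eventually_map_law_rangeSubset_pos` this never happens when
`(a_δ, b_δ)` is also an endpoint approximation of `D'`; by `isEndpointApprox_of_hull_bigSq` below it
never happens in the reference square. [folklore] -/
theorem not_avoidanceLimit_of_frequently_zero {D D' : DobrushinDomain} {a b : ℝ → Site 2}
    (hab : SAW.IsEndpointApprox D a b) (hsub : D'.carrier ⊆ D.carrier)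
    (h0 : D'.pt 0 = D.pt 0) (h1 : D'.pt 1 = D.pt 1)
    (hball : ∃ ε : ℝ, 0 < ε ∧ D'.carrier ∩ ball (D.pt 0) ε = D.carrier ∩ ball (D.pt 0) ε ∧
      D'.carrier ∩ ball (D.pt 1) ε = D.carrier ∩ ball (D.pt 1) ε)
    (hfreq : ∃ᶠ δ in 𝓝[>] (0 : ℝ), ((SAW.law D.carrier δ (a δ) (b δ)).map (fun γ ↦ γ.curve))
      (CurveClass.rangeSubset (closure D'.carrier)) = 0) :
    ¬ AvoidanceLimit := by
  intro h
  obtain ⟨φ, hφ⟩ := MarkedDomain.exists_isChordalUniformizing_holds D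
  have hstar : IsStarHull (φ.pullbackHull D') :=
    IsStarHull.pullbackHull JordanDomain.isSimplyConnected_holds hφ
      (isHullSubdomain_of_ball hsub h0 h1 hball)
  obtain ⟨Φ, hΦ, -⟩ := IsStarHull.existsUnique_isRestrictionMap_holds hstar
  obtain ⟨d, -, -, hd⟩ := IsStarHull.exists_hasRestrictionDeriv_holds hstar hΦ
  have hev := avoidanceLimit_eventually_pos h hab hsub h0 h1 hball hφ rfl hΦ hd
  obtain ⟨δ, hpos, hzero⟩ := (hev.and_frequently hfreq).exists
  exact hpos.ne' hzero

/-- **Kill criterion 2 (probability one).** A refutation "from above" must exhibit a hull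
subdomain `D' ≠ D` along which, for mesh sizes accumulating at `0`, EVERY self-avoiding walk of
`Ω_δ` from `a_δ` to `b_δ` stays in `closure D'` (`P_δ = 1` frequently) — the non-empty open set
`D ∖ closure D'` must be unusable by SAWs at those meshes. [folklore] -/
theorem not_avoidanceLimit_of_frequently_one {D D' : DobrushinDomain} {a b : ℝ → Site 2}
    (hab : SAW.IsEndpointApprox D a b) (hsub : D'.carrier ⊆ D.carrier)
    (h0 : D'.pt 0 = D.pt 0) (h1 : D'.pt 1 = D.pt 1)
    (hball : ∃ ε : ℝ, 0 < ε ∧ D'.carrier ∩ ball (D.pt 0) ε = D.carrier ∩ ball (D.pt 0) ε ∧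
      D'.carrier ∩ ball (D.pt 1) ε = D.carrier ∩ ball (D.pt 1) ε)
    (hne : (D.carrier \ D'.carrier).Nonempty)
    (hfreq : ∃ᶠ δ in 𝓝[>] (0 : ℝ), ((SAW.law D.carrier δ (a δ) (b δ)).map (fun γ ↦ γ.curve))
      (CurveClass.rangeSubset (closure D'.carrier)) = 1) :
    ¬ AvoidanceLimit := by
  intro h
  obtain ⟨φ, hφ⟩ := MarkedDomain.exists_isChordalUniformizing_holds D
  have hstar : IsStarHull (φ.pullbackHull D') :=
    IsStarHull.pullbackHull JordanDomain.isSimplyConnected_holds hφ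
      (isHullSubdomain_of_ball hsub h0 h1 hball)
  obtain ⟨Φ, hΦ, -⟩ := IsStarHull.existsUnique_isRestrictionMap_holds hstar
  obtain ⟨d, -, -, hd⟩ := IsStarHull.exists_hasRestrictionDeriv_holds hstar hΦ
  have hev := avoidanceLimit_eventually_lt_one h hab hsub h0 h1 hball hne hφ rfl hΦ hd
  obtain ⟨δ, hlt, hone⟩ := (hev.and_frequently hfreq).exists
  exact hlt.ne hone


end Summit.CriticalPhenomena.SAWScalingLimit.Theorems.AvoidanceLimit.Negative

end
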